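import Summits.CriticalPhenomena.PercolationContinuityZ3.Theorems.PercNearOneGluingNoHeavyLowerTailSahiOneStepTwoChainCube
import HarnessLib

/-!
# One-step scheme: `(2′)` for DISJOINTLY SUPPORTED increasing events — negative association of the Hamming-ball-conditioned product measure

Prover prim-ineq-prove-3 gen 25 (`--supports stmt-CriticalPhenomena-4575`; memo
`run/shared/lean/prim/prim-ineq-prove-3/FINDING-G25-DECOUPLING.md` §1).  No definitions, no named facts, no sorries, no `native_decide`.

Hypothesis `(2′)` of the one-step scheme, `0 ≤ n(1_A, 1_B)` for the first slot `H = {N_F ≥ t}`, reads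
`Cov(A,B) ≥ μ(Hᶜ)·Cov(A,B ∣ Hᶜ)`.  When the increasing events `A` and `B` are determined by DISJOINT sets of coordinates, `Cov(A,B) = 0` and
`(2′)` is exactly the (pairwise) NEGATIVE ASSOCIATION of the product measure conditioned on the Hamming ball `{N_F ≤ t−1}`:
`μ(A ∩ B ∣ N_F < t) ≤ μ(A ∣ N_F < t)·μ(B ∣ N_F < t)`.  We prove it for every product measure, every block `F`, every `t` and all such
pairs (`osN_disjoint_nonneg`), via the two-block grid `(N_{F∩S_A}, N_{F∖S_A})`: on a cell both events factor (independence of disjointly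
determined events), their cell masses are cross-monotone in the two counts (layer monotonicity), and the resulting grid inequality is the
TWO-CHAIN COLLAPSE THEOREM with BOTH slots fuzzy (`TwoChain.grid_collapse_fuzzy_fuzzy`, obtained from gen 24's `grid_collapse_cells` by a
layer-cake decomposition of the second slot along the running maximum of its layer densities).  With Q-HARRIS for all threshold slots
(`osMp_threshold_nonneg_all`) this gives **Kahn C5 / Sahi `C₃`** `0 ≤ E₃(1_{N_F ≥ t}, 1_A, 1_B)` for every Hamming-threshold first slot and
every pair of disjointly supported increasing events (`sahiE3_threshold_disjoint_nonneg`).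
-/

noncomputable section

namespace Summit.CriticalPhenomena.PercolationContinuityZ3.Theorems

namespace SahiOneStep

open MeasureTheory Finset
open Literature.Probability.Percolation (DeterminedBy determinedBy_iff determinedBy_univ prodBernoulli_real_eq_sum_weight_ind)
open Literature.Probability.LatticeModels (prodBernoulli sahiE3 prodBernoulli_real_inter_of_determinedBy_disjoint)
open Literature.Probability.Percolation.DecisionTree (ind ind_of_mem ind_of_not_mem ind_nonneg)
open scoped Classical

namespace TwoChain

/-! ## The two-chain collapse theorem with both slots fuzzy -/

/-- Layer-cake bookkeeping: a double `if`-sum against `Σ_{r ≤ J} c_r [r ≤ j]` is the `c`-combination of the double `if`-sums with the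
extra condition `r ≤ j`. [folklore] -/
theorem dsum_layer (K J : ℕ) (P : ℕ → ℕ → Prop) [∀ k, DecidablePred (P k)] (w : ℕ → ℕ → ℝ) (c : ℕ → ℝ) :
    (∑ k ∈ range K, ∑ j ∈ range J, if P k j then w k j * (∑ r ∈ range J, if r ≤ j then c r else 0) else 0) =
      ∑ r ∈ range J, c r * ∑ k ∈ range K, ∑ j ∈ range J, if P k j ∧ r ≤ j then w k j else 0 := by
  have h1 : ∀ k j, (if P k j then w k j * (∑ r ∈ range J, if r ≤ j then c r else 0) else 0) =
      ∑ r ∈ range J, c r * (if P k j ∧ r ≤ j then w k j else 0) := by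
    intro k j
    by_cases hP : P k j
    · rw [if_pos hP, Finset.mul_sum]
      refine Finset.sum_congr rfl fun r _ => ?_
      by_cases hr : r ≤ j
      · rw [if_pos hr, if_pos ⟨hP, hr⟩, mul_comm]
      · rw [if_neg hr, if_neg (fun h => hr h.2)]; ring
    · rw [if_neg hP]
      symm
      exact Finset.sum_eq_zero fun r _ => by rw [if_neg (fun h => hP h.1), mul_zero]
  simp_rw [h1]
  calc (∑ k ∈ range K, ∑ j ∈ range J, ∑ r ∈ range J, c r * (if P k j ∧ r ≤ j then w k j else 0))
      = ∑ k ∈ range K, ∑ r ∈ range J, ∑ j ∈ range J, c r * (if P k j ∧ r ≤ j then w k j else 0) :=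
        Finset.sum_congr rfl fun k _ => Finset.sum_comm
    _ = ∑ r ∈ range J, ∑ k ∈ range K, ∑ j ∈ range J, c r * (if P k j ∧ r ≤ j then w k j else 0) := Finset.sum_comm
    _ = ∑ r ∈ range J, c r * ∑ k ∈ range K, ∑ j ∈ range J, if P k j ∧ r ≤ j then w k j else 0 := by
        refine Finset.sum_congr rfl fun r _ => ?_
        rw [Finset.mul_sum]
        exact Finset.sum_congr rfl fun k _ => by rw [Finset.mul_sum]

/-- **TWO-CHAIN COLLAPSE, both slots fuzzy** (mass form).  For probability weights `a ⊗ b` on `{0..K}×{0..J}`, `H = {t ≤ k+j}`, `L = Hᶜ`,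
and layer masses `α ≤ a`, `β ≤ b` whose densities are nondecreasing (cross-monotonicity `α_k a_{k'} ≤ α_{k'} a_k`, `β_j b_{j'} ≤ β_{j'} b_j`
for `k ≤ k'`, `j ≤ j'`):
`(Σ_L α_k b_j)(Σ_L a_k β_j) + (Σ_L a b)(Σ_H α_k β_j) − (Σ_L a b)(Σ α_k b_j)(Σ a_k β_j) ≥ 0`.
Proof: layer-cake of the running maximum of the densities `β_j / b_j` reduces to `grid_collapse_cells` with `B = {r ≤ j}`. [this work] -/
theorem grid_collapse_fuzzy_fuzzy (K J t : ℕ) (a b α β : ℕ → ℝ)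
    (ha : ∀ k, 0 ≤ a k) (hb : ∀ j, 0 ≤ b j) (hα : ∀ k, 0 ≤ α k) (hαa : ∀ k, α k ≤ a k)
    (hβ : ∀ j, 0 ≤ β j) (hβb : ∀ j, β j ≤ b j)
    (F1 : ∀ k k', k ≤ k' → α k * a k' ≤ α k' * a k) (F2 : ∀ j j', j ≤ j' → β j * b j' ≤ β j' * b j)
    (hA1 : ∑ k ∈ range (K + 1), a k = 1) (hB1 : ∑ j ∈ range (J + 1), b j = 1) :
    0 ≤ (∑ k ∈ range (K + 1), ∑ j ∈ range (J + 1), if k + j < t then α k * b j else 0) *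
          (∑ k ∈ range (K + 1), ∑ j ∈ range (J + 1), if k + j < t then a k * β j else 0)
        + (∑ k ∈ range (K + 1), ∑ j ∈ range (J + 1), if k + j < t then a k * b j else 0) *
          (∑ k ∈ range (K + 1), ∑ j ∈ range (J + 1), if t ≤ k + j then α k * β j else 0)
        - (∑ k ∈ range (K + 1), ∑ j ∈ range (J + 1), if k + j < t then a k * b j else 0) *
          (∑ k ∈ range (K + 1), ∑ j ∈ range (J + 1), α k * b j) *
          (∑ k ∈ range (K + 1), ∑ j ∈ range (J + 1), a k * β j) := by
  -- densities of the second slot and their running maximum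
  set ψ : ℕ → ℝ := fun j => β j / b j with hψ
  set Ψ : ℕ → ℝ := fun j => partialSups ψ j with hΨ
  have hψ0 : ∀ j, 0 ≤ ψ j := fun j => div_nonneg (hβ j) (hb j)
  have hΨmono : Monotone Ψ := fun i j hij => (partialSups ψ).monotone hij
  have hΨψ : ∀ j, ψ j ≤ Ψ j := fun j => le_partialSups ψ j
  have hΨ0 : ∀ j, 0 ≤ Ψ j := fun j => (hψ0 j).trans (hΨψ j)
  -- `b_j Ψ_j = β_j`
  have hbΨ : ∀ j, b j * Ψ j = β j := by
    intro j
    rcases (hb j).eq_or_lt with hb0 | hbpos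
    · have hβ0 : β j = 0 := le_antisymm (hb0 ▸ hβb j) (hβ j)
      rw [← hb0, hβ0, zero_mul]
    · have hΨeq : Ψ j = ψ j := by
        refine le_antisymm (partialSups_le ψ j (ψ j) fun r hr => ?_) (hΨψ j)
        rcases (hb r).eq_or_lt with hr0 | hrpos
        · have : ψ r = 0 := by simp only [hψ]; rw [← hr0, div_zero]
          rw [this]; exact hψ0 j
        · simp only [hψ]
          rw [div_le_div_iff₀ hrpos hbpos]
          exact F2 r j hr
      rw [hΨeq]; simp only [hψ]; rw [mul_div_cancel₀ _ hbpos.ne']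
  -- layer-cake coefficients
  set c : ℕ → ℝ := fun r => if r = 0 then Ψ 0 else Ψ r - Ψ (r - 1) with hc
  have hc0 : ∀ r, 0 ≤ c r := by
    intro r
    simp only [hc]
    split_ifs with h
    · exact hΨ0 0
    · exact sub_nonneg.2 (hΨmono (Nat.sub_le r 1))
  have hcsum : ∀ j, ∑ r ∈ range (j + 1), c r = Ψ j := by
    intro j
    induction j with
    | zero => simp [hc]
    | succ n ih => rw [Finset.sum_range_succ, ih]; simp [hc]
  have hlayer : ∀ j ∈ range (J + 1), (∑ r ∈ range (J + 1), if r ≤ j then c r else 0) = Ψ j := by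
    intro j hj
    rw [← hcsum j, ← Finset.sum_filter]
    congr 1
    ext r
    simp only [Finset.mem_filter, Finset.mem_range]
    have := Finset.mem_range.1 hj
    omega
  -- rewrite the three `β`-sums as `c`-combinations of `{r ≤ j}`-sums
  have eβ : ∀ (P : ℕ → ℕ → Prop) [∀ k, DecidablePred (P k)] (w : ℕ → ℝ),
      (∑ k ∈ range (K + 1), ∑ j ∈ range (J + 1), if P k j then w k * β j else 0) =
        ∑ r ∈ range (J + 1), c r * ∑ k ∈ range (K + 1), ∑ j ∈ range (J + 1), if P k j ∧ r ≤ j then w k * b j else 0 := by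
    intro P _ w
    rw [← dsum_layer (K + 1) (J + 1) P (fun k j => w k * b j) c]
    refine Finset.sum_congr rfl fun k _ => Finset.sum_congr rfl fun j hj => ?_
    by_cases hP : P k j
    · rw [if_pos hP, if_pos hP, hlayer j hj, mul_assoc, hbΨ j]
    · rw [if_neg hP, if_neg hP]
  have eβ1 := eβ (fun k j => k + j < t) a
  have eβ2 := eβ (fun k j => t ≤ k + j) α
  have eβ3 : (∑ k ∈ range (K + 1), ∑ j ∈ range (J + 1), a k * β j) =
      ∑ r ∈ range (J + 1), c r * ∑ k ∈ range (K + 1), ∑ j ∈ range (J + 1), if True ∧ r ≤ j then a k * b j else 0 := by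
    rw [← eβ (fun _ _ => True) a]; simp
  -- each layer is an instance of `grid_collapse_cells` with `u k j = α_k b_j`, `B = {r ≤ j}`
  have hcells : ∀ r, 0 ≤
      (∑ k ∈ range (K + 1), ∑ j ∈ range (J + 1), if k + j < t then α k * b j else 0) *
          (∑ k ∈ range (K + 1), ∑ j ∈ range (J + 1), if k + j < t ∧ r ≤ j then a k * b j else 0)
        + (∑ k ∈ range (K + 1), ∑ j ∈ range (J + 1), if k + j < t then a k * b j else 0) *
          (∑ k ∈ range (K + 1), ∑ j ∈ range (J + 1), if t ≤ k + j ∧ r ≤ j then α k * b j else 0)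
        - (∑ k ∈ range (K + 1), ∑ j ∈ range (J + 1), if k + j < t then a k * b j else 0) *
          (∑ k ∈ range (K + 1), ∑ j ∈ range (J + 1), α k * b j) *
          (∑ k ∈ range (K + 1), ∑ j ∈ range (J + 1), if r ≤ j then a k * b j else 0) := by
    intro r
    exact grid_collapse_cells K J t a b (fun k j => α k * b j) (fun _ j => r ≤ j) ha hb
      (fun k j => mul_nonneg (hα k) (hb j)) (fun k j => mul_le_mul_of_nonneg_right (hαa k) (hb j))
      (fun k k' j hkk' => by nlinarith [F1 k k' hkk', hb j])
      (fun k j j' _ => le_of_eq (by ring)) hA1 hB1 (fun _ _ _ _ h => h) (fun _ _ _ hjj' h => h.trans hjj')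
  rw [eβ1, eβ2, eβ3]
  simp only [true_and]
  rw [Finset.mul_sum, Finset.mul_sum, Finset.mul_sum, ← Finset.sum_add_distrib, ← Finset.sum_sub_distrib]
  refine Finset.sum_nonneg fun r _ => ?_
  have h := mul_nonneg (hc0 r) (hcells r)
  nlinarith [h]

end TwoChain

variable {ι : Type*} [Fintype ι] [DecidableEq ι]

/-! ## `(2′)` for disjointly supported increasing events = negative association of the ball-conditioned product measure -/

/-- **`(2′)` FOR DISJOINTLY SUPPORTED EVENTS (pairwise negative association of `μ(· ∣ N_F < t)`).**  For every product measure, every block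
`F`, every `t`, and all increasing events `A`, `B` determined by DISJOINT finite sets of coordinates `SA`, `SB`:
`0 ≤ n(1_A, 1_B)` for the first slot `H = {N_F ≥ t}`, i.e. `μ(Hᶜ)·μ(A ∩ B ∩ Hᶜ) ≤ μ(A ∩ Hᶜ)·μ(B ∩ Hᶜ)` (as `Cov(A,B) = 0`). [this work] -/
theorem osN_disjoint_nonneg (p : ι → unitInterval) (F : Finset ι) (t : ℕ) {A B : Set (Set ι)}
    (hA : IsUpperSet A) (hB : IsUpperSet B) {SA SB : Finset ι} (hAS : DeterminedBy A (↑SA : Set ι))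
    (hBS : DeterminedBy B (↑SB : Set ι)) (hdisj : Disjoint SA SB) :
    0 ≤ osN p {ω : Set ι | t ≤ (F.filter (· ∈ ω)).card} (ind A) (ind B) := by
  set T : Finset ι := F.filter (· ∈ SA) with hT
  have hTF : T ⊆ F := Finset.filter_subset _ _
  set R : Finset ι := F \ T with hR
  have hTR : Disjoint T R := Finset.disjoint_sdiff
  have hTSA : T ⊆ SA := fun i hi => (Finset.mem_filter.1 hi).2
  have hSAR : Disjoint SA R := by
    rw [Finset.disjoint_left]
    intro i hiA hiR
    have hiF : i ∈ F := (Finset.mem_sdiff.1 hiR).1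
    exact (Finset.mem_sdiff.1 hiR).2 (Finset.mem_filter.2 ⟨hiF, hiA⟩)
  have hSA_SBR : Disjoint SA (SB ∪ R) := Finset.disjoint_union_right.2 ⟨hdisj, hSAR⟩
  have hT_SBR : Disjoint T (SB ∪ R) :=
    Finset.disjoint_union_right.2 ⟨Finset.disjoint_of_subset_left hTSA hdisj, hTR⟩
  set H : Set (Set ι) := {ω : Set ι | t ≤ (F.filter (· ∈ ω)).card} with hH
  -- layer events and their supports
  have hAk : ∀ k, DeterminedBy (A ∩ {ω' : Set ι | (T.filter (· ∈ ω')).card = k}) (↑SA : Set ι) := fun k =>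
    hAS.inter ((determinedBy_layer T k).mono (Finset.coe_subset.2 hTSA))
  have hBj : ∀ j, DeterminedBy (B ∩ {ω' : Set ι | (R.filter (· ∈ ω')).card = j}) (↑(SB ∪ R) : Set ι) := fun j => by
    rw [Finset.coe_union]
    exact (hBS.mono Set.subset_union_left).inter ((determinedBy_layer R j).mono Set.subset_union_right)
  have hRj : ∀ j, DeterminedBy {ω' : Set ι | (R.filter (· ∈ ω')).card = j} (↑(SB ∪ R) : Set ι) := fun j => by
    rw [Finset.coe_union]; exact (determinedBy_layer R j).mono Set.subset_union_right
  -- grid data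
  obtain ⟨a, ha⟩ : ∃ a : ℕ → ℝ, ∀ k, a k = (prodBernoulli p).real {ω' : Set ι | (T.filter (· ∈ ω')).card = k} := ⟨_, fun _ => rfl⟩
  obtain ⟨b, hb⟩ : ∃ b : ℕ → ℝ, ∀ j, b j = (prodBernoulli p).real {ω' : Set ι | (R.filter (· ∈ ω')).card = j} := ⟨_, fun _ => rfl⟩
  obtain ⟨α, hα⟩ : ∃ α : ℕ → ℝ, ∀ k, α k = (prodBernoulli p).real (A ∩ {ω' : Set ι | (T.filter (· ∈ ω')).card = k}) :=
    ⟨_, fun _ => rfl⟩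
  obtain ⟨β, hβ⟩ : ∃ β : ℕ → ℝ, ∀ j, β j = (prodBernoulli p).real (B ∩ {ω' : Set ι | (R.filter (· ∈ ω')).card = j}) :=
    ⟨_, fun _ => rfl⟩
  have ha0 : ∀ k, 0 ≤ a k := fun k => by rw [ha]; exact measureReal_nonneg
  have hb0 : ∀ j, 0 ≤ b j := fun j => by rw [hb]; exact measureReal_nonneg
  have hα0 : ∀ k, 0 ≤ α k := fun k => by rw [hα]; exact measureReal_nonneg
  have hβ0 : ∀ j, 0 ≤ β j := fun j => by rw [hβ]; exact measureReal_nonneg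
  have hαa : ∀ k, α k ≤ a k := fun k => by rw [hα, ha]; exact measureReal_mono Set.inter_subset_right
  have hβb : ∀ j, β j ≤ b j := fun j => by rw [hβ, hb]; exact measureReal_mono Set.inter_subset_right
  have F1 : ∀ k k', k ≤ k' → α k * a k' ≤ α k' * a k := fun k k' hkk' => by
    have h := real_inter_inter_layer_mul_le p T hA (determinedBy_univ ((↑T : Set ι)ᶜ)) hkk'
    rw [Set.inter_univ] at h
    rw [hα, hα, ha, ha]; exact h
  have F2 : ∀ j j', j ≤ j' → β j * b j' ≤ β j' * b j := fun j j' hjj' => by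
    have h := real_inter_inter_layer_mul_le p R hB (determinedBy_univ ((↑R : Set ι)ᶜ)) hjj'
    rw [Set.inter_univ] at h
    rw [hβ, hβ, hb, hb]; exact h
  have hA1 : ∑ k ∈ range (T.card + 1), a k = 1 := by
    rw [Finset.sum_congr rfl fun k _ => ha k]; exact sum_real_layer_eq_one p T
  have hB1 : ∑ j ∈ range (R.card + 1), b j = 1 := by
    rw [Finset.sum_congr rfl fun j _ => hb j]; exact sum_real_layer_eq_one p R
  have hgrid := TwoChain.grid_collapse_fuzzy_fuzzy T.card R.card t a b α β ha0 hb0 hα0 hαa hβ0 hβb F1 F2 hA1 hB1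
  -- the four cell products
  have cAB : ∀ k j, (prodBernoulli p).real ((A ∩ B) ∩ {ω' : Set ι | (R.filter (· ∈ ω')).card = j} ∩
      {ω' : Set ι | (T.filter (· ∈ ω')).card = k}) = α k * β j := fun k j => by
    have hset : (A ∩ B) ∩ {ω' : Set ι | (R.filter (· ∈ ω')).card = j} ∩ {ω' : Set ι | (T.filter (· ∈ ω')).card = k} =
        (A ∩ {ω' : Set ι | (T.filter (· ∈ ω')).card = k}) ∩ (B ∩ {ω' : Set ι | (R.filter (· ∈ ω')).card = j}) := by
      ext ω; simp only [Set.mem_inter_iff, Set.mem_setOf_eq]; tauto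
    rw [hset, hα, hβ]
    exact prodBernoulli_real_inter_of_determinedBy_disjoint p hSA_SBR (hAk k) (hBj j)
      MeasurableSet.of_discrete MeasurableSet.of_discrete
  have cA : ∀ k j, (prodBernoulli p).real (A ∩ {ω' : Set ι | (R.filter (· ∈ ω')).card = j} ∩
      {ω' : Set ι | (T.filter (· ∈ ω')).card = k}) = α k * b j := fun k j => by
    have hset : A ∩ {ω' : Set ι | (R.filter (· ∈ ω')).card = j} ∩ {ω' : Set ι | (T.filter (· ∈ ω')).card = k} =
        (A ∩ {ω' : Set ι | (T.filter (· ∈ ω')).card = k}) ∩ {ω' : Set ι | (R.filter (· ∈ ω')).card = j} := by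
      ext ω; simp only [Set.mem_inter_iff, Set.mem_setOf_eq]; tauto
    rw [hset, hα, hb]
    exact prodBernoulli_real_inter_of_determinedBy_disjoint p hSA_SBR (hAk k) (hRj j)
      MeasurableSet.of_discrete MeasurableSet.of_discrete
  have cB : ∀ k j, (prodBernoulli p).real (B ∩ {ω' : Set ι | (R.filter (· ∈ ω')).card = j} ∩
      {ω' : Set ι | (T.filter (· ∈ ω')).card = k}) = a k * β j := fun k j => by
    have hset : B ∩ {ω' : Set ι | (R.filter (· ∈ ω')).card = j} ∩ {ω' : Set ι | (T.filter (· ∈ ω')).card = k} =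
        {ω' : Set ι | (T.filter (· ∈ ω')).card = k} ∩ (B ∩ {ω' : Set ι | (R.filter (· ∈ ω')).card = j}) := by
      ext ω; simp only [Set.mem_inter_iff, Set.mem_setOf_eq]; tauto
    rw [hset, ha, hβ]
    exact prodBernoulli_real_inter_of_determinedBy_disjoint p hT_SBR (determinedBy_layer T k) (hBj j)
      MeasurableSet.of_discrete MeasurableSet.of_discrete
  have cU : ∀ k j, (prodBernoulli p).real (Set.univ ∩ {ω' : Set ι | (R.filter (· ∈ ω')).card = j} ∩
      {ω' : Set ι | (T.filter (· ∈ ω')).card = k}) = a k * b j := fun k j => by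
    rw [ha, hb]; exact real_cell_eq_mul p hTR k j
  -- membership in `H` on a cell
  have memH : ∀ ω : Set ι, ∀ k j, (T.filter (· ∈ ω)).card = k → (R.filter (· ∈ ω)).card = j → (ω ∈ H ↔ t ≤ k + j) := by
    intro ω k j hk hj
    rw [hH, Set.mem_setOf_eq, card_filter_mem_eq_add F hTF ω, hk, ← hR, hj]
  -- the six measures as grid sums
  have eHA : (prodBernoulli p).real (H ∩ A) = ∑ k ∈ range (T.card + 1), ∑ j ∈ range (R.card + 1),
      if t ≤ k + j then α k * b j else 0 := by
    rw [real_eq_sum_cells p T R]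
    refine Finset.sum_congr rfl fun k _ => Finset.sum_congr rfl fun j _ => ?_
    rw [← cA]
    exact real_inter_cell_eq_ite p T R (C := H ∩ A) (V := A) (P := t ≤ k + j) fun ω hk hj => by
      rw [Set.mem_inter_iff, memH ω k j hk hj]
  have eHB : (prodBernoulli p).real (H ∩ B) = ∑ k ∈ range (T.card + 1), ∑ j ∈ range (R.card + 1),
      if t ≤ k + j then a k * β j else 0 := by
    rw [real_eq_sum_cells p T R]
    refine Finset.sum_congr rfl fun k _ => Finset.sum_congr rfl fun j _ => ?_
    rw [← cB]
    exact real_inter_cell_eq_ite p T R (C := H ∩ B) (V := B) (P := t ≤ k + j) fun ω hk hj => by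
      rw [Set.mem_inter_iff, memH ω k j hk hj]
  have eH : (prodBernoulli p).real H = ∑ k ∈ range (T.card + 1), ∑ j ∈ range (R.card + 1),
      if t ≤ k + j then a k * b j else 0 := by
    rw [real_eq_sum_cells p T R]
    refine Finset.sum_congr rfl fun k _ => Finset.sum_congr rfl fun j _ => ?_
    rw [← cU]
    exact real_inter_cell_eq_ite p T R (C := H) (V := Set.univ) (P := t ≤ k + j) fun ω hk hj => by
      rw [memH ω k j hk hj]; simp
  have eHAB : (prodBernoulli p).real (H ∩ A ∩ B) = ∑ k ∈ range (T.card + 1), ∑ j ∈ range (R.card + 1),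
      if t ≤ k + j then α k * β j else 0 := by
    rw [real_eq_sum_cells p T R]
    refine Finset.sum_congr rfl fun k _ => Finset.sum_congr rfl fun j _ => ?_
    rw [← cAB]
    exact real_inter_cell_eq_ite p T R (C := H ∩ A ∩ B) (V := A ∩ B) (P := t ≤ k + j) fun ω hk hj => by
      rw [Set.mem_inter_iff, Set.mem_inter_iff, Set.mem_inter_iff, memH ω k j hk hj]; tauto
  have eA : (prodBernoulli p).real A = ∑ k ∈ range (T.card + 1), ∑ j ∈ range (R.card + 1), α k * b j := by
    rw [real_eq_sum_cells p T R]
    exact Finset.sum_congr rfl fun k _ => Finset.sum_congr rfl fun j _ => cA k j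
  have eB : (prodBernoulli p).real B = ∑ k ∈ range (T.card + 1), ∑ j ∈ range (R.card + 1), a k * β j := by
    rw [real_eq_sum_cells p T R]
    exact Finset.sum_congr rfl fun k _ => Finset.sum_congr rfl fun j _ => cB k j
  -- `L`-sums versus `H`-sums
  have splitL : ∀ w : ℕ → ℕ → ℝ, (∑ k ∈ range (T.card + 1), ∑ j ∈ range (R.card + 1), if k + j < t then w k j else 0) =
      (∑ k ∈ range (T.card + 1), ∑ j ∈ range (R.card + 1), w k j) -
        ∑ k ∈ range (T.card + 1), ∑ j ∈ range (R.card + 1), if t ≤ k + j then w k j else 0 := by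
    intro w
    rw [eq_sub_iff_add_eq, ← Finset.sum_add_distrib]
    refine Finset.sum_congr rfl fun k _ => ?_
    rw [← Finset.sum_add_distrib]
    refine Finset.sum_congr rfl fun j _ => ?_
    by_cases h : k + j < t
    · rw [if_pos h, if_neg (by omega), add_zero]
    · rw [if_neg h, if_pos (by omega), zero_add]
  have hab1 : (∑ k ∈ range (T.card + 1), ∑ j ∈ range (R.card + 1), a k * b j) = 1 := by
    rw [← Finset.sum_mul_sum, hA1, hB1, mul_one]
  rw [splitL (fun k j => α k * b j), splitL (fun k j => a k * β j), splitL (fun k j => a k * b j), hab1] at hgrid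
  rw [osN_ind_ind, eHA, eHB, eH, eHAB, eA, eB]
  nlinarith [hgrid]

/-- **KAHN C5 / SAHI `C₃` FOR A HAMMING THRESHOLD AND TWO DISJOINTLY SUPPORTED INCREASING EVENTS.**  For every product measure, every block
`F`, every `t` and all increasing `A`, `B` determined by disjoint finite coordinate sets: `0 ≤ E₃(1_{N_F ≥ t}, 1_A, 1_B)`. [this work] -/
theorem sahiE3_threshold_disjoint_nonneg (p : ι → unitInterval) (F : Finset ι) (t : ℕ) {A B : Set (Set ι)}
    (hA : IsUpperSet A) (hB : IsUpperSet B) {SA SB : Finset ι} (hAS : DeterminedBy A (↑SA : Set ι))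
    (hBS : DeterminedBy B (↑SB : Set ι)) (hdisj : Disjoint SA SB) :
    0 ≤ sahiE3 (prodBernoulli p) {ω : Set ι | t ≤ (F.filter (· ∈ ω)).card} A B := by
  rw [← osT_ind_ind, osT_eq_osMp_add_osN]
  exact add_nonneg (osMp_threshold_nonneg_all p F t hA hB) (osN_disjoint_nonneg p F t hA hB hAS hBS hdisj)

/-- **Negative association, covariance form.**  Under the same hypotheses, with `L = {N_F < t}`:
`μ(L)·μ(A ∩ B ∩ L) ≤ μ(A ∩ L)·μ(B ∩ L)`. [this work] -/
theorem ball_real_inter_mul_le (p : ι → unitInterval) (F : Finset ι) (t : ℕ) {A B : Set (Set ι)}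
    (hA : IsUpperSet A) (hB : IsUpperSet B) {SA SB : Finset ι} (hAS : DeterminedBy A (↑SA : Set ι))
    (hBS : DeterminedBy B (↑SB : Set ι)) (hdisj : Disjoint SA SB) :
    (prodBernoulli p).real {ω : Set ι | (F.filter (· ∈ ω)).card < t} *
        (prodBernoulli p).real (A ∩ B ∩ {ω : Set ι | (F.filter (· ∈ ω)).card < t}) ≤
      (prodBernoulli p).real (A ∩ {ω : Set ι | (F.filter (· ∈ ω)).card < t}) *
        (prodBernoulli p).real (B ∩ {ω : Set ι | (F.filter (· ∈ ω)).card < t}) := by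
  have h := osN_disjoint_nonneg p F t hA hB hAS hBS hdisj
  rw [osN_ind_ind] at h
  set H : Set (Set ι) := {ω : Set ι | t ≤ (F.filter (· ∈ ω)).card} with hH
  have hLH : {ω : Set ι | (F.filter (· ∈ ω)).card < t} = Hᶜ := by
    ext ω; simp only [hH, Set.mem_compl_iff, Set.mem_setOf_eq, not_le]
  have hAB : (prodBernoulli p).real (A ∩ B) = (prodBernoulli p).real A * (prodBernoulli p).real B :=
    prodBernoulli_real_inter_of_determinedBy_disjoint p hdisj hAS hBS MeasurableSet.of_discrete MeasurableSet.of_discrete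
  have cH : (prodBernoulli p).real Hᶜ = 1 - (prodBernoulli p).real H := by
    rw [measureReal_compl MeasurableSet.of_discrete, probReal_univ]
  have cX : ∀ X : Set (Set ι), (prodBernoulli p).real (X ∩ Hᶜ) = (prodBernoulli p).real X - (prodBernoulli p).real (H ∩ X) := by
    intro X
    have h1 := measureReal_inter_add_sdiff (μ := prodBernoulli p) (s := X) (MeasurableSet.of_discrete (s := H))
    rw [Set.sdiff_eq, Set.inter_comm X H] at h1
    linarith
  rw [hLH, cH, cX, cX, cX, hAB]
  have e3 : (prodBernoulli p).real (H ∩ (A ∩ B)) = (prodBernoulli p).real (H ∩ A ∩ B) := by rw [Set.inter_assoc]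
  rw [e3]
  nlinarith [h]

end SahiOneStep

end Summit.CriticalPhenomena.PercolationContinuityZ3.Theorems
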